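import Mathlib
import HarnessLib

/-!
# S1a — R4e preliminaries, POLYNOMIAL LEVEL: the derivative identity at a rational critical point and `∂₁G_q`

[OURS · L1 W4.5c · lead-1 g16; plan-1 RULING R-F15p ★ R4e-rational `graphTail_killsIn_two` — the hunit of the graph member on the chart of the critical point `αᵢ`
is `−∂₁G_q = −X₁^{mᵢ}·((mᵢ+1)w + Xw′)(x_none X₁)` and `(mᵢ+1)w + Xw′ = c·∏_{j≠i}(X + αᵢ − αⱼ)^{mⱼ}` when `g′ = c∏ⱼ(X − αⱼ)^{mⱼ}` and `g(X+αᵢ) − g(αᵢ) = X^{mᵢ+1}w`; every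
factor becomes a unit on the chart `D(x₁′)∩D(hhᵢ)`] — NOT statements of the manuscript; counted 0; AI-level work, weaker than expert review.
Crux stmt-ResolutionOfSingularities-17941 `CyclicQuotientFourfolds`, line `s1a-logminvertex` v13 (`stub_reachLowerInFX`).

* `GraphTail.local_derivative_eq` — `(m i + 1)•w + X·w′ = C c · ∏_{j ≠ i} (X + C (α i − α j))^{m j}` in `k[X]`;
* `GraphTail.pderiv_one_Gq` — `∂₁ (X₁^{m+1}·w(X₀X₁)) = X₁^m · ((m+1)•w + X·w′)(X₀X₁)` in `k[X₀, X₁]`.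
-/

set_option linter.dupNamespace false

noncomputable section

open Polynomial

namespace Summit.ResolutionOfSingularities.ResolutionOfSingularities.Theorems.WildQuotientResolution.S1.GraphTail

variable {k : Type} [Field k]

/-- **The derivative identity at a rational critical point**: from `g′ = c·∏ⱼ (X − αⱼ)^{mⱼ}` and `g(X + αᵢ) − g(αᵢ) = X^{mᵢ+1}·w` one gets
`(mᵢ+1)•w + X·w′ = c·∏_{j≠i} (X + (αᵢ − αⱼ))^{mⱼ}`. [folklore] -/
theorem local_derivative_eq {r : ℕ} (g : k[X]) (α : Fin r → k) (m : Fin r → ℕ) (c : k)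
    (hg' : derivative g = C c * ∏ j, (X - C (α j)) ^ m j) (i : Fin r) (wl : k[X])
    (hw : g.comp (X + C (α i)) - C (g.eval (α i)) = X ^ (m i + 1) * wl) :
    ((m i + 1 : ℕ) : k[X]) * wl + X * derivative wl = C c * ∏ j ∈ Finset.univ.erase i, (X + C (α i - α j)) ^ m j := by
  classical
  -- differentiate the local factorisation
  have hd := congrArg derivative hw
  rw [derivative_sub, derivative_C, sub_zero, derivative_comp, derivative_X_add_C, one_mul, hg', mul_comp, C_comp, prod_comp,
    derivative_mul, derivative_X_pow] at hd
  simp only [pow_comp, sub_comp, X_comp, C_comp] at hd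
  -- split off the factor `j = i`
  rw [← Finset.mul_prod_erase Finset.univ (fun j => (X + C (α i) - C (α j)) ^ m j) (Finset.mem_univ i)] at hd
  simp only [add_sub_cancel_right] at hd
  have hfac : ∀ j ∈ Finset.univ.erase i, (X + C (α i) - C (α j)) ^ m j = (X + C (α i - α j)) ^ m j := fun j _ => by rw [C_sub, add_sub_assoc]
  rw [Finset.prod_congr rfl hfac] at hd
  -- cancel `X ^ m i`
  have hX : (X : k[X]) ^ m i ≠ 0 := pow_ne_zero _ X_ne_zero
  apply mul_left_cancel₀ hX
  rw [show (X : k[X]) ^ m i * (((m i + 1 : ℕ) : k[X]) * wl + X * derivative wl) =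
      C ((m i + 1 : ℕ) : k) * X ^ (m i + 1 - 1) * wl + X ^ (m i + 1) * derivative wl by rw [Nat.add_sub_cancel, map_natCast]; ring, ← hd]
  ring

/-- **`∂₁ G_q`** for `G_q = X₁^{m+1}·w(X₀X₁)`: `∂₁G_q = X₁^m · ((m+1)•w + X·w′)(X₀X₁)`. [folklore] -/
theorem pderiv_one_Gq (m : ℕ) (wl : k[X]) :
    MvPolynomial.pderiv 1 (MvPolynomial.X 1 ^ (m + 1) * aeval (MvPolynomial.X 0 * MvPolynomial.X 1 : MvPolynomial (Fin 2) k) wl : MvPolynomial (Fin 2) k) =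
      MvPolynomial.X 1 ^ m * aeval (MvPolynomial.X 0 * MvPolynomial.X 1 : MvPolynomial (Fin 2) k) (((m + 1 : ℕ) : k[X]) * wl + X * derivative wl) := by
  have h01 : MvPolynomial.pderiv 1 (MvPolynomial.X 0 * MvPolynomial.X 1 : MvPolynomial (Fin 2) k) = MvPolynomial.X 0 := by
    rw [MvPolynomial.pderiv_mul, MvPolynomial.pderiv_X_self, MvPolynomial.pderiv_X_of_ne (show (0 : Fin 2) ≠ 1 by decide), zero_mul, zero_add, mul_one]
  rw [MvPolynomial.pderiv_mul, Derivation.map_aeval, h01, MvPolynomial.pderiv_pow, MvPolynomial.pderiv_X_self, smul_eq_mul, map_add, map_mul, map_mul,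
    map_natCast, Polynomial.aeval_X, Nat.add_sub_cancel, mul_one]
  ring

end Summit.ResolutionOfSingularities.ResolutionOfSingularities.Theorems.WildQuotientResolution.S1.GraphTail

end
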